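import Summits.QuantumFields.YangMills.Theorems.ColdStartUniversalityColdStartSolutionsExistVecPicardStep
import HarnessLib

/-!
# Route `ColdStartUniversality`, support item S (stmt-QuantumFields-24811), line `piwiener`:
# vector Picard iteration II — the contraction estimate, finiteness of `Φ_T(X⁰, X¹)`, invariance of the step

Helper file (lead `ym-line-csu-p1`) for stub A `stub_ambientStrongExistence`; port of the sections
`PicardEstimates` / `PicardStepBound` of the tree's 1-D `Literature/Analysis/FunctionSpaces/ItoProcessesProofs.lean`
(Revuz–Yor IX (2.1), existence half) to Lipschitz SYSTEMS driven by a Brownian vector (see part I,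
`…VecPicardStep`).  For two invariant processes `U, U'` and Picard steps `V = S U`, `V' = S U'`:

* `vecPicard_contraction` — `E[sup_{s≤t} |V_s − V'_s|²] ≤ C(T) · E ∫₀ᵗ |U_r − U'_r|² dr` for `t ≤ T`, with
  `C(T) = |ι|·(2TK) + 8|ι||κ|²K` (pathwise Cauchy–Schwarz for the drift, coordinate by coordinate via the
  tree's `iSup_sq_le_of_integral_repr`; Doob–Itô `L²` bound for each of the `|ι||κ|` martingale parts,
  `lintegral_iSup_itoIntegral_coord_sub_sq_le`);
* `vecPicard_inv_const` — constants are invariant; `vecPicard_const_step_lt_top` — `Φ_T(x₀, S x₀) < ∞`;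
  `vecPicard_step_progressive`, `vecPicard_step_continuous` — the step is progressive, a.s. continuous.

No definition, no sorry.  RECORD-rung plumbing; nothing here bears on the Yang–Mills mass gap. -/

set_option autoImplicit false

noncomputable section

namespace Summit.QuantumFields.YangMills.Theorems.ColdStartUniversality

open MeasureTheory ProbabilityTheory Filter Topology Finset
open scoped NNReal ENNReal BigOperators
open Literature.Probability.Process Literature.Analysis.FunctionSpaces

section Generic

variable {Ω : Type*} {mΩ : MeasurableSpace Ω} {𝓕 : Filtration ℝ≥0 mΩ} {ι : Type*} [Fintype ι]

/-- `sup_s ofReal (Σ_i f_i(s)) ≤ Σ_i sup_s ofReal (f_i(s))` for nonnegative `f_i`. [folklore] -/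
theorem vecPicard_iSup_ofReal_sum_le {τ : Type*} (S : Set τ) (f : ι → τ → ℝ) (hf : ∀ i s, 0 ≤ f i s) :
    ⨆ s ∈ S, ENNReal.ofReal (∑ i, f i s) ≤ ∑ i, ⨆ s ∈ S, ENNReal.ofReal (f i s) := by
  refine iSup₂_le fun s hs => ?_
  rw [ENNReal.ofReal_sum_of_nonneg fun i _ => hf i s]
  exact Finset.sum_le_sum fun i _ => le_iSup₂_of_le s hs le_rfl

/-- A finite sum of progressive real processes is progressive. [folklore] -/
theorem vecPicard_isStronglyProgressive_finsum {κ : Type*} [Fintype κ] {Z : κ → ℝ≥0 → Ω → ℝ}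
    (hZ : ∀ n, IsStronglyProgressive 𝓕 (Z n)) :
    IsStronglyProgressive 𝓕 (fun s ω => ∑ n, Z n s ω) := by
  intro t
  letI : MeasurableSpace (Set.Iic t × Ω) := Subtype.instMeasurableSpace.prod (𝓕 t)
  exact (Finset.measurable_sum (Finset.univ : Finset κ) fun n _ => (hZ n t).measurable).stronglyMeasurable

/-- Joint measurability `(ω, r) ↦ ofReal (Z_{r⁺}(ω))` of a progressive process read in real time, and
measurability of `ω ↦ ∫⁻_{[0,t]} ofReal (Z_{r⁺}(ω)) dr`. [folklore] -/
theorem vecPicard_measurable_lintegral_Icc {Z : ℝ≥0 → Ω → ℝ} (hZ : IsStronglyProgressive 𝓕 Z)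
    (t : ℝ≥0) : Measurable fun ω => ∫⁻ r in Set.Icc (0 : ℝ) t, ENNReal.ofReal (Z r.toNNReal ω) := by
  have hZm := IsStronglyProgressive.measurable_uncurry hZ
  have hF : Measurable (fun q : Ω × ℝ => ENNReal.ofReal (Z q.2.toNNReal q.1)) :=
    (hZm.comp ((measurable_real_toNNReal.comp measurable_snd).prodMk measurable_fst)).ennreal_ofReal
  exact hF.lintegral_prod_right

end Generic

section Estimates

variable {Ω : Type*} {mΩ : MeasurableSpace Ω} {P : Measure Ω} {d : ℕ}
  {W : ℝ≥0 → Ω → (Fin d → ℝ)} {ι κ : Type*} [Fintype ι] [Fintype κ]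
  {b : (ι → ℝ) → ι → ℝ} {σ : (ι → ℝ) → ι → κ → ℝ} {c : ι → κ → Fin d} {K : ℝ} {x₀ : ι → ℝ}

/-- **The contraction estimate of the vector Picard step** (RY IX (2.1):
`Φ_t(SU, SU') ≤ C E∫₀ᵗ |U_r − U'_r|² dr`): for invariant `U, U'` (coordinatewise progressive, a.s.
continuous) and steps `V = S U`, `V' = S U'` with their Itô integrals `JV, JV'`,
`E[sup_{s≤t} Σ_i (V_i − V'_i)²(s)] ≤ (|ι|(2TK) + 8|ι||κ|²K) · E ∫₀ᵗ Σ_i (U_i − U'_i)²(r) dr` for `t ≤ T`.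
Revuz–Yor (1999), Ch. IX, proof of Thm (2.1). [folklore] -/
theorem vecPicard_contraction [IsProbabilityMeasure P] (hW : IsBrownianVec W P) (hK : 0 ≤ K)
    (hb : ∀ x y : ι → ℝ, ∑ i, (b x i - b y i) ^ 2 ≤ K * ∑ i, (x i - y i) ^ 2)
    (hσ : ∀ x y : ι → ℝ, ∑ i, ∑ n, (σ x i n - σ y i n) ^ 2 ≤ K * ∑ i, (x i - y i) ^ 2)
    {U U' V V' : ι → ℝ≥0 → Ω → ℝ} {JV JV' : ι → κ → ℝ≥0 → Ω → ℝ}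
    (hU : ∀ i, IsStronglyProgressive hW.natFiltration (U i)) (hUc : ∀ᵐ ω ∂P, ∀ i, Continuous fun t => U i t ω)
    (hU' : ∀ i, IsStronglyProgressive hW.natFiltration (U' i))
    (hU'c : ∀ᵐ ω ∂P, ∀ i, Continuous fun t => U' i t ω)
    (hJV : ∀ i n, IsItoIntegral (fun s ω => σ (fun j => U j s ω) i n) (fun s ω => W s ω (c i n)) (JV i n)
        hW.natFiltration P ∧ IsStronglyProgressive hW.natFiltration (JV i n))
    (hV : ∀ i t ω, V i t ω = x₀ i + timeIntegral (fun s ω => b (fun j => U j s ω) i) t ω + ∑ n, JV i n t ω)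
    (hJV' : ∀ i n, IsItoIntegral (fun s ω => σ (fun j => U' j s ω) i n) (fun s ω => W s ω (c i n)) (JV' i n)
        hW.natFiltration P ∧ IsStronglyProgressive hW.natFiltration (JV' i n))
    (hV' : ∀ i t ω, V' i t ω = x₀ i + timeIntegral (fun s ω => b (fun j => U' j s ω) i) t ω + ∑ n, JV' i n t ω)
    (T : ℝ≥0) :
    ∀ t ≤ T, ∫⁻ ω, ⨆ s ∈ Set.Iic t, ENNReal.ofReal (∑ i, (V i s ω - V' i s ω) ^ 2) ∂P ≤
      ((Fintype.card ι : ℝ≥0∞) * ENNReal.ofReal (2 * T * K) +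
          8 * (Fintype.card ι : ℝ≥0∞) * (Fintype.card κ : ℝ≥0∞) ^ 2 * ENNReal.ofReal K) *
        ∫⁻ ω, (∫⁻ r in Set.Icc (0 : ℝ) t,
          ENNReal.ofReal (∑ i, (U i r.toNNReal ω - U' i r.toNNReal ω) ^ 2)) ∂P := by
  intro t ht
  have hb' := vecPicard_coord_sq_le_of_sum hb
  have hσ' := vecPicard_coord_sq_le_of_sum₂ hσ
  have hbcont : ∀ i, Continuous fun x => b x i := fun i => vecPicard_continuous_coord hK hb' i
  have hσcont : ∀ i n, Continuous fun x => σ x i n := fun i n =>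
    vecPicard_continuous_coord (f := fun x (p : ι × κ) => σ x p.1 p.2) hK hσ' (i, n)
  -- abbreviations
  set E : ℝ≥0 → Ω → ℝ := fun r ω => ∑ j, (U j r ω - U' j r ω) ^ 2 with hEdef
  have hE0 : ∀ r ω, 0 ≤ E r ω := fun r ω => Finset.sum_nonneg fun _ _ => sq_nonneg _
  have hEprog : IsStronglyProgressive hW.natFiltration E := vecPicard_isStronglyProgressive_sumSq hU hU'
  have hIm : Measurable fun ω => ∫⁻ r in Set.Icc (0 : ℝ) t, ENNReal.ofReal (E r.toNNReal ω) :=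
    vecPicard_measurable_lintegral_Icc hEprog t
  -- Step A: pathwise bound, almost surely
  have hpath : ∀ᵐ ω ∂P, ⨆ s ∈ Set.Iic t, ENNReal.ofReal (∑ i, (V i s ω - V' i s ω) ^ 2) ≤
      (Fintype.card ι : ℝ≥0∞) * (ENNReal.ofReal (2 * t * K) *
          ∫⁻ r in Set.Icc (0 : ℝ) t, ENNReal.ofReal (E r.toNNReal ω)) +
        2 * ((Fintype.card κ : ℝ≥0∞) * ∑ i, ∑ n,
          ⨆ s ∈ Set.Iic t, ENNReal.ofReal ((JV i n s ω - JV' i n s ω) ^ 2)) := by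
    filter_upwards [hUc, hU'c] with ω hωU hωU'
    -- per coordinate
    have hcoord : ∀ i, ⨆ s ∈ Set.Iic t, ENNReal.ofReal ((V i s ω - V' i s ω) ^ 2) ≤
        ENNReal.ofReal (2 * t * K) * (∫⁻ r in Set.Icc (0 : ℝ) t, ENNReal.ofReal (E r.toNNReal ω)) +
          2 * ⨆ s ∈ Set.Iic t, ENNReal.ofReal ((∑ n, (JV i n s ω - JV' i n s ω)) ^ 2) := by
      intro i
      have hEc : Continuous fun r => E r ω := by
        simp only [hEdef]
        exact continuous_finsetSum _ fun j _ => ((hωU j).sub (hωU' j)).pow 2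
      have hec : Continuous fun r => Real.sqrt (E r ω) := Real.continuous_sqrt.comp hEc
      obtain ⟨M, hM⟩ : ∃ M, ∀ s ≤ t, |Real.sqrt (E s ω)| ≤ M := by
        obtain ⟨M, hM⟩ := (isCompact_Icc (a := (0 : ℝ≥0)) (b := t)).exists_bound_of_continuousOn
          hec.continuousOn
        exact ⟨M, fun s hs => by simpa [Real.norm_eq_abs] using hM s ⟨bot_le, hs⟩⟩
      have hgc : Continuous fun r => b (fun j => U j r ω) i - b (fun j => U' j r ω) i :=
        ((hbcont i).comp (continuous_pi fun j => hωU j)).sub ((hbcont i).comp (continuous_pi fun j => hωU' j))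
      have hintU : ∀ s : ℝ≥0, IntervalIntegrable (fun r : ℝ => b (fun j => U j r.toNNReal ω) i) volume 0 s :=
        fun s => ((hbcont i).comp (continuous_pi fun j => (hωU j).comp
          continuous_real_toNNReal)).intervalIntegrable _ _
      have hintU' : ∀ s : ℝ≥0, IntervalIntegrable (fun r : ℝ => b (fun j => U' j r.toNNReal ω) i) volume 0 s :=
        fun s => ((hbcont i).comp (continuous_pi fun j => (hωU' j).comp
          continuous_real_toNNReal)).intervalIntegrable _ _
      have h := iSup_sq_le_of_integral_repr (K := Real.sqrt K) (M := M) (t := t)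
        (d := fun s => V i s ω - V' i s ω)
        (j := fun s => ∑ n, (JV i n s ω - JV' i n s ω))
        (g := fun r => b (fun j => U j r ω) i - b (fun j => U' j r ω) i)
        (e := fun r => Real.sqrt (E r ω)) (Real.sqrt_nonneg K) (fun s => ?_) (fun r => ?_) hM
        (hgc.comp continuous_real_toNNReal).measurable (hec.comp continuous_real_toNNReal).measurable
      · have hKK : Real.sqrt K ^ 2 = K := Real.sq_sqrt hK
        have hee : ∀ r : ℝ, Real.sqrt (E r.toNNReal ω) ^ 2 = E r.toNNReal ω := fun r =>
          Real.sq_sqrt (hE0 _ _)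
        simp only [hKK, hee] at h
        exact h
      · -- the representation `d s = ∫₀ˢ g + j s`
        simp only [hV, hV', timeIntegral]
        rw [intervalIntegral.integral_sub (hintU s) (hintU' s), Finset.sum_sub_distrib]
        ring
      · -- the Lipschitz bound `g² ≤ (√K)² e²`
        rw [Real.sq_sqrt hK, Real.sq_sqrt (hE0 _ _)]
        exact hb' _ _ i
    -- sum over coordinates
    calc ⨆ s ∈ Set.Iic t, ENNReal.ofReal (∑ i, (V i s ω - V' i s ω) ^ 2)
        ≤ ∑ i, ⨆ s ∈ Set.Iic t, ENNReal.ofReal ((V i s ω - V' i s ω) ^ 2) :=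
          vecPicard_iSup_ofReal_sum_le _ (fun i s => (V i s ω - V' i s ω) ^ 2) fun _ _ => sq_nonneg _
      _ ≤ ∑ i, (ENNReal.ofReal (2 * t * K) * (∫⁻ r in Set.Icc (0 : ℝ) t, ENNReal.ofReal (E r.toNNReal ω)) +
            2 * ⨆ s ∈ Set.Iic t, ENNReal.ofReal ((∑ n, (JV i n s ω - JV' i n s ω)) ^ 2)) :=
          Finset.sum_le_sum fun i _ => hcoord i
      _ ≤ ∑ i, (ENNReal.ofReal (2 * t * K) * (∫⁻ r in Set.Icc (0 : ℝ) t, ENNReal.ofReal (E r.toNNReal ω)) +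
            2 * ((Fintype.card κ : ℝ≥0∞) *
              ∑ n, ⨆ s ∈ Set.Iic t, ENNReal.ofReal ((JV i n s ω - JV' i n s ω) ^ 2))) := by
          gcongr with i _
          have h := iSup_ofReal_sq_sum_le (Finset.univ : Finset κ) (fun n s => JV i n s ω - JV' i n s ω)
            (Set.Iic t)
          rwa [Finset.card_univ] at h
      _ = _ := by
          rw [Finset.sum_add_distrib, Finset.sum_const, Finset.card_univ, nsmul_eq_mul, ← Finset.mul_sum,
            ← Finset.mul_sum]
  -- Step B: integrate; Doob for each martingale part
  have hsupmeas : ∀ i n, AEMeasurable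
      (fun ω => ⨆ s ∈ Set.Iic t, ENNReal.ofReal ((JV i n s ω - JV' i n s ω) ^ 2)) P := by
    intro i n
    refine aemeasurable_biSup_Iic (Z := fun s ω => JV i n s ω - JV' i n s ω)
      (φ := fun x => ENNReal.ofReal (x ^ 2)) (ENNReal.continuous_ofReal.comp (continuous_pow 2))
      (fun s => (vecPicard_measurable (hJV i n).2 s).sub (vecPicard_measurable (hJV' i n).2 s)) ?_ t
    filter_upwards [(hJV i n).1.continuous, (hJV' i n).1.continuous] with ω h1 h2
    exact h1.sub h2
  have hDoob : ∀ i n, ∫⁻ ω, ⨆ s ∈ Set.Iic t, ENNReal.ofReal ((JV i n s ω - JV' i n s ω) ^ 2) ∂P ≤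
      4 * (ENNReal.ofReal K * ∫⁻ ω, (∫⁻ r in Set.Icc (0 : ℝ) t, ENNReal.ofReal (E r.toNNReal ω)) ∂P) := by
    intro i n
    have h := lintegral_iSup_itoIntegral_coord_sub_sq_le hW (c i n)
      (vecPicard_isStronglyProgressive_comp hU (hσcont i n))
      (vecPicard_isStronglyProgressive_comp hU' (hσcont i n)) (hJV i n).1 (hJV' i n).1 t
    refine h.trans ?_
    gcongr
    rw [← lintegral_const_mul _ hIm]
    refine lintegral_mono fun ω => ?_
    rw [← lintegral_const_mul' _ _ ENNReal.ofReal_ne_top]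
    refine lintegral_mono fun r => ?_
    rw [← ENNReal.ofReal_mul hK]
    exact ENNReal.ofReal_le_ofReal (hσ' _ _ (i, n))
  have htK : ENNReal.ofReal (2 * t * K) ≤ ENNReal.ofReal (2 * T * K) := by
    refine ENNReal.ofReal_le_ofReal ?_
    have : (t : ℝ) ≤ T := NNReal.coe_le_coe.2 ht
    nlinarith
  -- measurability bookkeeping for splitting the integral
  have hSS : AEMeasurable (fun ω => ∑ i, ∑ n,
      ⨆ s ∈ Set.Iic t, ENNReal.ofReal ((JV i n s ω - JV' i n s ω) ^ 2)) P :=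
    Finset.aemeasurable_fun_sum _ fun i _ => Finset.aemeasurable_fun_sum _ fun n _ => hsupmeas i n
  have hsplit : ∫⁻ ω, 2 * ((Fintype.card κ : ℝ≥0∞) * ∑ i, ∑ n,
        ⨆ s ∈ Set.Iic t, ENNReal.ofReal ((JV i n s ω - JV' i n s ω) ^ 2)) ∂P =
      2 * ((Fintype.card κ : ℝ≥0∞) * ∑ i, ∑ n,
        ∫⁻ ω, ⨆ s ∈ Set.Iic t, ENNReal.ofReal ((JV i n s ω - JV' i n s ω) ^ 2) ∂P) := by
    rw [lintegral_const_mul'' _ (hSS.const_mul _), lintegral_const_mul'' _ hSS,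
      lintegral_finsetSum' _ fun i _ => Finset.aemeasurable_fun_sum _ fun n _ => hsupmeas i n]
    congr 2
    refine Finset.sum_congr rfl fun i _ => ?_
    rw [lintegral_finsetSum' _ fun n _ => hsupmeas i n]
  have hA : Measurable fun ω => (Fintype.card ι : ℝ≥0∞) * (ENNReal.ofReal (2 * t * K) *
      ∫⁻ r in Set.Icc (0 : ℝ) t, ENNReal.ofReal (E r.toNNReal ω)) := (hIm.const_mul _).const_mul _
  calc ∫⁻ ω, ⨆ s ∈ Set.Iic t, ENNReal.ofReal (∑ i, (V i s ω - V' i s ω) ^ 2) ∂P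
      ≤ ∫⁻ ω, ((Fintype.card ι : ℝ≥0∞) * (ENNReal.ofReal (2 * t * K) *
            ∫⁻ r in Set.Icc (0 : ℝ) t, ENNReal.ofReal (E r.toNNReal ω)) +
          2 * ((Fintype.card κ : ℝ≥0∞) * ∑ i, ∑ n,
            ⨆ s ∈ Set.Iic t, ENNReal.ofReal ((JV i n s ω - JV' i n s ω) ^ 2))) ∂P :=
        lintegral_mono_ae hpath
    _ = (Fintype.card ι : ℝ≥0∞) * (ENNReal.ofReal (2 * t * K) *
            ∫⁻ ω, (∫⁻ r in Set.Icc (0 : ℝ) t, ENNReal.ofReal (E r.toNNReal ω)) ∂P) +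
          2 * ((Fintype.card κ : ℝ≥0∞) * ∑ i, ∑ n,
            ∫⁻ ω, ⨆ s ∈ Set.Iic t, ENNReal.ofReal ((JV i n s ω - JV' i n s ω) ^ 2) ∂P) := by
        rw [lintegral_add_left hA, lintegral_const_mul _ (hIm.const_mul _), lintegral_const_mul _ hIm, hsplit]
    _ ≤ (Fintype.card ι : ℝ≥0∞) * (ENNReal.ofReal (2 * T * K) *
            ∫⁻ ω, (∫⁻ r in Set.Icc (0 : ℝ) t, ENNReal.ofReal (E r.toNNReal ω)) ∂P) +
          2 * ((Fintype.card κ : ℝ≥0∞) * ∑ _i : ι, ∑ _n : κ,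
            4 * (ENNReal.ofReal K * ∫⁻ ω, (∫⁻ r in Set.Icc (0 : ℝ) t, ENNReal.ofReal (E r.toNNReal ω)) ∂P)) := by
        refine add_le_add (mul_le_mul' le_rfl (mul_le_mul' htK le_rfl)) ?_
        refine mul_le_mul' le_rfl (mul_le_mul' le_rfl ?_)
        exact Finset.sum_le_sum fun i _ => Finset.sum_le_sum fun n _ => hDoob i n
    _ = _ := by
        rw [Finset.sum_const, Finset.sum_const, Finset.card_univ, Finset.card_univ, nsmul_eq_mul,
          nsmul_eq_mul]
        ring

/-- **Constant processes are invariant** (`X⁰ ≡ x₀`): coordinatewise progressive, continuous, `L²(sup)`.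
[folklore] -/
theorem vecPicard_inv_const [IsProbabilityMeasure P] (hW : IsBrownianVec W P) (x₀ : ι → ℝ) :
    (∀ i, IsStronglyProgressive hW.natFiltration ((fun i (_ : ℝ≥0) (_ : Ω) => x₀ i) i)) ∧
      (∀ᵐ ω ∂P, ∀ i, Continuous fun t => (fun i (_ : ℝ≥0) (_ : Ω) => x₀ i) i t ω) ∧
      ∀ t : ℝ≥0, ∫⁻ ω, ⨆ s ∈ Set.Iic t,
        ENNReal.ofReal (∑ i, (fun i (_ : ℝ≥0) (_ : Ω) => x₀ i) i s ω ^ 2) ∂P < ∞ := by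
  refine ⟨fun i => isStronglyProgressive_const _ (x₀ i), ae_of_all _ fun _ _ => continuous_const,
    fun t => ?_⟩
  calc ∫⁻ ω, ⨆ s ∈ Set.Iic t, ENNReal.ofReal (∑ i, (fun i (_ : ℝ≥0) (_ : Ω) => x₀ i) i s ω ^ 2) ∂P
      ≤ ∫⁻ _, ENNReal.ofReal (∑ i, x₀ i ^ 2) ∂P := lintegral_mono fun ω => iSup₂_le fun s _ => le_rfl
    _ < ⊤ := by rw [lintegral_const]; exact ENNReal.mul_lt_top ENNReal.ofReal_lt_top (measure_lt_top _ _)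


/-- **The Picard step is coordinatewise progressive** (constant + time integral of a progressive
integrand + finite sum of progressive Itô integrals). [folklore] -/
theorem vecPicard_step_progressive (hW : IsBrownianVec W P) (hK : 0 ≤ K)
    (hb : ∀ x y : ι → ℝ, ∑ i, (b x i - b y i) ^ 2 ≤ K * ∑ i, (x i - y i) ^ 2)
    {U V : ι → ℝ≥0 → Ω → ℝ} {JV : ι → κ → ℝ≥0 → Ω → ℝ}
    (hU : ∀ i, IsStronglyProgressive hW.natFiltration (U i))
    (hJVp : ∀ i n, IsStronglyProgressive hW.natFiltration (JV i n))
    (hV : ∀ i t ω, V i t ω = x₀ i + timeIntegral (fun s ω => b (fun j => U j s ω) i) t ω + ∑ n, JV i n t ω) :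
    ∀ i, IsStronglyProgressive hW.natFiltration (V i) := by
  intro i
  have hbcont : Continuous fun x => b x i := vecPicard_continuous_coord hK (vecPicard_coord_sq_le_of_sum hb) i
  have hVeq : V i = fun t ω => x₀ i + timeIntegral (fun s ω => b (fun j => U j s ω) i) t ω + ∑ n, JV i n t ω :=
    funext fun t => funext fun ω => hV i t ω
  rw [hVeq]
  exact ((isStronglyProgressive_const _ (x₀ i)).add
    (isStronglyProgressive_timeIntegral (vecPicard_isStronglyProgressive_comp hU hbcont))).add
    (vecPicard_isStronglyProgressive_finsum fun n => hJVp i n)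

/-- **The Picard step has a.s. continuous paths** (time integral of a continuous integrand along a.s.
continuous paths; Itô integrals are a.s. continuous). [folklore] -/
theorem vecPicard_step_continuous (hW : IsBrownianVec W P) (hK : 0 ≤ K)
    (hb : ∀ x y : ι → ℝ, ∑ i, (b x i - b y i) ^ 2 ≤ K * ∑ i, (x i - y i) ^ 2)
    {U V : ι → ℝ≥0 → Ω → ℝ} {JV : ι → κ → ℝ≥0 → Ω → ℝ}
    (hUc : ∀ᵐ ω ∂P, ∀ i, Continuous fun t => U i t ω)
    (hJV : ∀ i n, IsItoIntegral (fun s ω => σ (fun j => U j s ω) i n) (fun s ω => W s ω (c i n)) (JV i n)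
        hW.natFiltration P)
    (hV : ∀ i t ω, V i t ω = x₀ i + timeIntegral (fun s ω => b (fun j => U j s ω) i) t ω + ∑ n, JV i n t ω) :
    ∀ᵐ ω ∂P, ∀ i, Continuous fun t => V i t ω := by
  have hbcont : ∀ i, Continuous fun x => b x i := fun i =>
    vecPicard_continuous_coord hK (vecPicard_coord_sq_le_of_sum hb) i
  have hJc : ∀ᵐ ω ∂P, ∀ i n, Continuous fun t => JV i n t ω := by
    rw [ae_all_iff]; intro i; rw [ae_all_iff]; intro n
    exact (hJV i n).continuous
  filter_upwards [hUc, hJc] with ω hωU hωJ i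
  have hVeq : (fun t => V i t ω) = fun t =>
      x₀ i + timeIntegral (fun s ω => b (fun j => U j s ω) i) t ω + ∑ n, JV i n t ω := funext fun t => hV i t ω
  rw [hVeq]
  exact (continuous_const.add (vecPicard_continuous_timeIntegral (hbcont i) hωU)).add
    (continuous_finsetSum _ fun n _ => hωJ i n)

/-- **Finiteness of `Φ_T(X⁰, X¹)`** ("using the properties of f it is easy to check that
`D = Φ_T(X⁰, X¹)` is finite", RY IX (2.1)): for the step `V = S x₀` of the CONSTANT process,
`E[sup_{s≤T} Σ_i (x₀ i − V_i(s))²] < ∞` (bounded drift integrand; Doob for the martingale parts against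
the zero integral). Revuz–Yor (1999), Ch. IX, proof of Thm (2.1). [folklore] -/
theorem vecPicard_const_step_lt_top [IsProbabilityMeasure P] (hW : IsBrownianVec W P) (hK : 0 ≤ K)
    (hσ : ∀ x y : ι → ℝ, ∑ i, ∑ n, (σ x i n - σ y i n) ^ 2 ≤ K * ∑ i, (x i - y i) ^ 2)
    {U V : ι → ℝ≥0 → Ω → ℝ} {JV : ι → κ → ℝ≥0 → Ω → ℝ} (hUconst : ∀ i t ω, U i t ω = x₀ i)
    (hJV : ∀ i n, IsItoIntegral (fun s ω => σ (fun j => U j s ω) i n) (fun s ω => W s ω (c i n)) (JV i n)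
        hW.natFiltration P ∧ IsStronglyProgressive hW.natFiltration (JV i n))
    (hV : ∀ i t ω, V i t ω = x₀ i + timeIntegral (fun s ω => b (fun j => U j s ω) i) t ω + ∑ n, JV i n t ω)
    (T : ℝ≥0) :
    ∫⁻ ω, ⨆ s ∈ Set.Iic T, ENNReal.ofReal (∑ i, (x₀ i - V i s ω) ^ 2) ∂P < ∞ := by
  have hσcont : ∀ i n, Continuous fun x => σ x i n := fun i n =>
    vecPicard_continuous_coord (f := fun x (p : ι × κ) => σ x p.1 p.2) hK (vecPicard_coord_sq_le_of_sum₂ hσ) (i, n)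
  have hUfun : ∀ j, U j = fun _ _ => x₀ j := fun j => funext fun t => funext fun ω => hUconst j t ω
  have hUprog : ∀ j, IsStronglyProgressive hW.natFiltration (U j) := fun j => by
    rw [hUfun j]; exact isStronglyProgressive_const _ _
  -- an Itô integral of the zero integrand, per noise coordinate: it vanishes
  have hzero : ∀ i n, ∃ Jz : ℝ≥0 → Ω → ℝ, IsItoIntegral (fun _ _ => (0 : ℝ)) (fun s ω => W s ω (c i n)) Jz
      hW.natFiltration P ∧ ∀ᵐ ω ∂P, ∀ t, Jz t ω = 0 := by
    intro i n
    obtain ⟨Jz, hJz, -, -⟩ := exists_isItoIntegral_coord hW (c i n) (H := fun _ _ => (0 : ℝ))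
      (isStronglyProgressive_const _ (0 : ℝ)) fun t => by simp [sqErr]
    exact ⟨Jz, hJz, hJz.ae_forall_eq_zero_of_integrand⟩
  choose Jz hJz hJz0 using hzero
  -- Doob bound for each martingale part
  have hDoob : ∀ i n, ∫⁻ ω, ⨆ s ∈ Set.Iic T, ENNReal.ofReal ((JV i n s ω) ^ 2) ∂P < ∞ := by
    intro i n
    have heq : ∫⁻ ω, ⨆ s ∈ Set.Iic T, ENNReal.ofReal ((JV i n s ω) ^ 2) ∂P =
        ∫⁻ ω, ⨆ s ∈ Set.Iic T, ENNReal.ofReal ((JV i n s ω - Jz i n s ω) ^ 2) ∂P := by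
      refine lintegral_congr_ae ?_
      filter_upwards [hJz0 i n] with ω hω
      simp only [hω, sub_zero]
    rw [heq]
    have h := lintegral_iSup_itoIntegral_coord_sub_sq_le hW (c i n)
      (vecPicard_isStronglyProgressive_comp hUprog (hσcont i n)) (isStronglyProgressive_const _ (0 : ℝ))
      (hJV i n).1 (hJz i n) T
    refine lt_of_le_of_lt h ?_
    have hbd : ∫⁻ ω, (∫⁻ r in Set.Icc (0 : ℝ) T, ENNReal.ofReal
        ((σ (fun j => U j r.toNNReal ω) i n - (fun (_ : ℝ≥0) (_ : Ω) => (0 : ℝ)) r.toNNReal ω) ^ 2)) ∂P =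
        ∫⁻ _ω, ENNReal.ofReal ((σ x₀ i n) ^ 2) * volume (Set.Icc (0 : ℝ) T) ∂P := by
      refine lintegral_congr fun ω => ?_
      rw [← setLIntegral_const]
      refine setLIntegral_congr_fun measurableSet_Icc fun r _ => ?_
      simp only [hUconst, sub_zero]
    rw [hbd, lintegral_const]
    exact ENNReal.mul_lt_top (by norm_num) (ENNReal.mul_lt_top (ENNReal.mul_lt_top ENNReal.ofReal_lt_top
      measure_Icc_lt_top) (measure_lt_top _ _))
  -- pathwise bound
  have hpt : ∀ ω, ⨆ s ∈ Set.Iic T, ENNReal.ofReal (∑ i, (x₀ i - V i s ω) ^ 2) ≤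
      ENNReal.ofReal (2 * (T : ℝ) ^ 2 * ∑ i, (b x₀ i) ^ 2) +
        2 * ((Fintype.card κ : ℝ≥0∞) * ∑ i, ∑ n, ⨆ s ∈ Set.Iic T, ENNReal.ofReal ((JV i n s ω) ^ 2)) := by
    intro ω
    refine iSup₂_le fun s hs => ?_
    have hs' : (s : ℝ) ≤ T := NNReal.coe_le_coe.2 hs
    have hTI : ∀ i, timeIntegral (fun s ω => b (fun j => U j s ω) i) s ω = (s : ℝ) * b x₀ i := by
      intro i
      simp only [timeIntegral, hUconst]
      rw [intervalIntegral.integral_const, smul_eq_mul, sub_zero]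
    have hterm : ∀ i, (x₀ i - V i s ω) ^ 2 ≤ 2 * ((T : ℝ) ^ 2 * (b x₀ i) ^ 2) +
        2 * (∑ n, JV i n s ω) ^ 2 := by
      intro i
      rw [hV i s ω, hTI i]
      have h1 : (x₀ i - (x₀ i + (s : ℝ) * b x₀ i + ∑ n, JV i n s ω)) ^ 2 =
          ((s : ℝ) * b x₀ i + ∑ n, JV i n s ω) ^ 2 := by ring
      rw [h1]
      have h2 : ((s : ℝ) * b x₀ i) ^ 2 ≤ (T : ℝ) ^ 2 * (b x₀ i) ^ 2 := by
        rw [mul_pow]; exact mul_le_mul_of_nonneg_right (pow_le_pow_left₀ s.coe_nonneg hs' 2) (sq_nonneg _)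
      nlinarith [sq_nonneg ((s : ℝ) * b x₀ i - ∑ n, JV i n s ω)]
    calc ENNReal.ofReal (∑ i, (x₀ i - V i s ω) ^ 2)
        ≤ ENNReal.ofReal (∑ i, (2 * ((T : ℝ) ^ 2 * (b x₀ i) ^ 2) + 2 * (∑ n, JV i n s ω) ^ 2)) :=
          ENNReal.ofReal_le_ofReal (Finset.sum_le_sum fun i _ => hterm i)
      _ = ENNReal.ofReal (2 * (T : ℝ) ^ 2 * ∑ i, (b x₀ i) ^ 2) +
            2 * ∑ i, ENNReal.ofReal ((∑ n, JV i n s ω) ^ 2) := by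
          rw [Finset.sum_add_distrib, ← Finset.mul_sum, ← Finset.mul_sum, ← mul_assoc, ← Finset.mul_sum,
            ENNReal.ofReal_add (by positivity) (by positivity), ENNReal.ofReal_mul (by norm_num : (0:ℝ) ≤ 2),
            ENNReal.ofReal_ofNat, ENNReal.ofReal_sum_of_nonneg fun i _ => sq_nonneg _]
      _ ≤ ENNReal.ofReal (2 * (T : ℝ) ^ 2 * ∑ i, (b x₀ i) ^ 2) +
            2 * ∑ i, ((Fintype.card κ : ℝ≥0∞) * ∑ n, ⨆ s ∈ Set.Iic T, ENNReal.ofReal ((JV i n s ω) ^ 2)) := by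
          gcongr with i _
          have h := iSup_ofReal_sq_sum_le (Finset.univ : Finset κ) (fun n s => JV i n s ω) (Set.Iic T)
          rw [Finset.card_univ] at h
          exact (le_iSup₂_of_le (f := fun s (_ : s ∈ Set.Iic T) => ENNReal.ofReal ((∑ n, JV i n s ω) ^ 2))
            s hs le_rfl).trans h
      _ = _ := by rw [← Finset.mul_sum]
  have hsupmeas : ∀ i n, AEMeasurable (fun ω => ⨆ s ∈ Set.Iic T, ENNReal.ofReal ((JV i n s ω) ^ 2)) P := by
    intro i n
    exact aemeasurable_biSup_Iic (Z := fun s ω => JV i n s ω) (φ := fun x => ENNReal.ofReal (x ^ 2))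
      (ENNReal.continuous_ofReal.comp (continuous_pow 2)) (fun s => vecPicard_measurable (hJV i n).2 s)
      (hJV i n).1.continuous T
  have hSS : AEMeasurable (fun ω => ∑ i, ∑ n, ⨆ s ∈ Set.Iic T, ENNReal.ofReal ((JV i n s ω) ^ 2)) P :=
    Finset.aemeasurable_fun_sum _ fun i _ => Finset.aemeasurable_fun_sum _ fun n _ => hsupmeas i n
  calc ∫⁻ ω, ⨆ s ∈ Set.Iic T, ENNReal.ofReal (∑ i, (x₀ i - V i s ω) ^ 2) ∂P
      ≤ ∫⁻ ω, (ENNReal.ofReal (2 * (T : ℝ) ^ 2 * ∑ i, (b x₀ i) ^ 2) +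
          2 * ((Fintype.card κ : ℝ≥0∞) * ∑ i, ∑ n, ⨆ s ∈ Set.Iic T, ENNReal.ofReal ((JV i n s ω) ^ 2))) ∂P :=
        lintegral_mono hpt
    _ = ENNReal.ofReal (2 * (T : ℝ) ^ 2 * ∑ i, (b x₀ i) ^ 2) * P Set.univ +
          2 * ((Fintype.card κ : ℝ≥0∞) * ∑ i, ∑ n, ∫⁻ ω, ⨆ s ∈ Set.Iic T, ENNReal.ofReal ((JV i n s ω) ^ 2) ∂P) := by
        rw [lintegral_add_left measurable_const, lintegral_const, lintegral_const_mul'' _ (hSS.const_mul _),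
          lintegral_const_mul'' _ hSS,
          lintegral_finsetSum' _ fun i _ => Finset.aemeasurable_fun_sum _ fun n _ => hsupmeas i n]
        congr 3
        refine Finset.sum_congr rfl fun i _ => ?_
        rw [lintegral_finsetSum' _ fun n _ => hsupmeas i n]
    _ < ⊤ := by
        refine ENNReal.add_lt_top.2 ⟨ENNReal.mul_lt_top ENNReal.ofReal_lt_top (measure_lt_top _ _), ?_⟩
        refine ENNReal.mul_lt_top (by norm_num) (ENNReal.mul_lt_top (by simp) ?_)
        exact ENNReal.sum_lt_top.2 fun i _ => ENNReal.sum_lt_top.2 fun n _ => hDoob i n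

end Estimates

end Summit.QuantumFields.YangMills.Theorems.ColdStartUniversality

end
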